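import Mathlib
import Literature.Computability.Complexity.RangeAvoidance
import Summits.PneNP.PneNP.Theorems.SfmBlBlockSplit

/-!
# The PIECES PACKAGE of an instance (§0 of `exists_cutCertified`, packaged for the machine closer M5)

FRONTIER F-N1c; nothing here bears on P vs NP.

`SfmBl.exists_cutCertified` builds, inline, the free block splitting of the legs `e = (j, t) : Fin m × Fin 3` of a
3-local instance `I` into pieces of leg-degree `≤ 2^60` with `N ≤ 2n + 1 + 6m/2^60` pieces (`SfmBlBlockSplit`).
The parametric pipeline theorem `SfmBl.cutCertified_of_pipeline` takes such a piece structure as HYPOTHESES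
(`src, dst, own₁, own₂`, four compatibilities, two degree bounds, `1 ≤ N ≤ 2n+1+6m/2^60`).  `pieces_package` hands
the same canonical splitting to M5 as ONE existential statement, together with the DICTIONARY to the machine's
labels (`SfmBlMachinePieces`: left vertex `c_j`, right vertex coded `none ↦ 0 / some v ↦ v+1`, block index
`rank / 2^60` with `rank = #{earlier legs (index 3j'+t' < 3j+t) at the same vertex}` — `rankL_eq_card`,
`rankR_eq_card`): pieces are `Σ v : Fin n, Fin (nb₁ v)` / `Σ v : Option (Fin n), Fin (nb₂ v)` with owner
`Sigma.fst` and block `Sigma.snd`.  `card_filter_legIdx` converts leg counts over `Fin m × Fin 3` into counts over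
the machine's index range `{i < 3m}`.  Definition-free.
-/

namespace Summit.PneNP.PneNP.Theorems.SfmBl

open Finset BigOperators Literature.Computability.Complexity

/-- Leg counts over `Fin m × Fin 3` = counts over the machine's leg indices `i = 3j + t < 3m`. -/
theorem card_filter_legIdx {m : ℕ} (P : ℕ → Prop) [DecidablePred P] :
    (univ.filter fun e : Fin m × Fin 3 => P (3 * e.1.val + e.2.val)).card
      = ((Finset.range (3 * m)).filter P).card := by
  refine Finset.card_bij (fun e _ => 3 * e.1.val + e.2.val) (fun e he => ?_) (fun e₁ h₁ e₂ h₂ h => ?_)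
    (fun i hi => ?_)
  · simp only [Finset.mem_filter, Finset.mem_univ, true_and] at he
    simp only [Finset.mem_filter, Finset.mem_range]
    exact ⟨by have := e.1.isLt; have := e.2.isLt; omega, he⟩
  · have h1 : e₁.1.val = e₂.1.val := by have := e₁.2.isLt; have := e₂.2.isLt; omega
    have h2 : e₁.2.val = e₂.2.val := by have := e₁.2.isLt; have := e₂.2.isLt; omega
    exact Prod.ext (Fin.ext h1) (Fin.ext h2)
  · simp only [Finset.mem_filter, Finset.mem_range] at hi
    refine ⟨(⟨i / 3, by omega⟩, ⟨i % 3, by omega⟩), ?_, by simp only; omega⟩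
    simp only [Finset.mem_filter, Finset.mem_univ, true_and]
    have : 3 * (i / 3) + i % 3 = i := by omega
    rw [this]; exact hi.2

/-- … and the earlier-leg condition moves into the range: `#{i' < M | Q i' ∧ i' < i} = #{i' < i | Q i'}` for
`i ≤ M` (the shape of `SfmBlMachine.rankL_eq_card` / `rankR_eq_card`). -/
theorem card_range_filter_and_lt {M i : ℕ} (hi : i ≤ M) (Q : ℕ → Prop) [DecidablePred Q] :
    ((Finset.range M).filter fun i' => Q i' ∧ i' < i).card = ((Finset.range i).filter Q).card := by
  congr 1
  ext i'
  simp only [Finset.mem_filter, Finset.mem_range]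
  constructor
  · rintro ⟨-, hq, hlt⟩; exact ⟨hlt, hq⟩
  · rintro ⟨hlt, hq⟩; exact ⟨by omega, hq, hlt⟩

/-- **THE PIECES PACKAGE.**  For a 3-local instance with `0 < n`: block counts `nb₁, nb₂`, piece maps `src, dst`
into `Σ v, Fin (nb v)` (owner = `Sigma.fst`, block = `Sigma.snd`), with (1)–(4) the dictionary (owner and block
index of every leg, block = rank / 2^60), (5)–(8) the four compatibilities of `cutCertified_of_pipeline` with
`own := Sigma.fst`, (9)–(10) leg-degrees `≤ 2^60`, (11)–(12) `1 ≤ N ≤ 2n + 1 + 6m/2^60`. -/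
theorem pieces_package {n m : ℕ} (I : LocalMap 3 n m) (hn : 0 < n) :
    ∃ (nb₁ : Fin n → ℕ) (nb₂ : Option (Fin n) → ℕ)
      (src : Fin m × Fin 3 → (Σ v : Fin n, Fin (nb₁ v)))
      (dst : Fin m × Fin 3 → (Σ v : Option (Fin n), Fin (nb₂ v))),
      (∀ e, (src e).1 = I.vars e.1 0) ∧
      (∀ e, ((src e).2 : ℕ) = (univ.filter fun e' : Fin m × Fin 3 =>
          I.vars e'.1 0 = I.vars e.1 0 ∧ 3 * e'.1.val + e'.2.val < 3 * e.1.val + e.2.val).card / 2 ^ 60) ∧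
      (∀ e, (dst e).1 = if e.2 = 0 then none else some (I.vars e.1 e.2)) ∧
      (∀ e, ((dst e).2 : ℕ) = (univ.filter fun e' : Fin m × Fin 3 =>
          (if e'.2 = 0 then none else some (I.vars e'.1 e'.2)) = (if e.2 = 0 then none else some (I.vars e.1 e.2))
            ∧ 3 * e'.1.val + e'.2.val < 3 * e.1.val + e.2.val).card / 2 ^ 60) ∧
      (∀ j ℓ, (src (j, ℓ)).1 = I.vars j 0) ∧ (∀ j, (dst (j, 0)).1 = none) ∧
      (∀ j, (dst (j, 1)).1 = some (I.vars j 1)) ∧ (∀ j, (dst (j, 2)).1 = some (I.vars j 2)) ∧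
      (∀ i, (univ.filter fun e => src e = i).card ≤ 2 ^ 60) ∧
      (∀ k, (univ.filter fun e => dst e = k).card ≤ 2 ^ 60) ∧
      1 ≤ Fintype.card (Σ v : Fin n, Fin (nb₁ v)) + Fintype.card (Σ v : Option (Fin n), Fin (nb₂ v)) ∧
      ((Fintype.card (Σ v : Fin n, Fin (nb₁ v)) : ℝ) + Fintype.card (Σ v : Option (Fin n), Fin (nb₂ v)))
        ≤ 2 * n + 1 + 6 * m / 2 ^ 60 := by
  classical
  obtain ⟨vert₁, hvert₁⟩ : ∃ vert₁ : Fin m × Fin 3 → Fin n, vert₁ = fun e => I.vars e.1 0 := ⟨_, rfl⟩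
  obtain ⟨vert₂, hvert₂⟩ : ∃ vert₂ : Fin m × Fin 3 → Option (Fin n),
      vert₂ = fun e => if e.2 = 0 then none else some (I.vars e.1 e.2) := ⟨_, rfl⟩
  obtain ⟨idx, hidx⟩ : ∃ idx : Fin m × Fin 3 → ℕ, idx = fun e => 3 * e.1.val + e.2.val := ⟨_, rfl⟩
  have hidxinj : Function.Injective idx := by
    intro a b h
    rw [hidx] at h
    simp only at h
    have h1 : a.1.val = b.1.val := by have := a.2.isLt; have := b.2.isLt; omega
    have h2 : a.2.val = b.2.val := by omega
    exact Prod.ext (Fin.ext h1) (Fin.ext h2)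
  have hL : 0 < (2 ^ 60 : ℕ) := Nat.pos_of_ne_zero (by norm_num)
  let nb₁ : Fin n → ℕ := fun v =>
    max 1 (((Finset.univ.filter fun e' : Fin m × Fin 3 => vert₁ e' = v).card + 2 ^ 60 - 1) / 2 ^ 60)
  let nb₂ : Option (Fin n) → ℕ := fun v =>
    max 1 (((Finset.univ.filter fun e' : Fin m × Fin 3 => vert₂ e' = v).card + 2 ^ 60 - 1) / 2 ^ 60)
  let src : Fin m × Fin 3 → (Σ v : Fin n, Fin (nb₁ v)) := fun e =>
    ⟨vert₁ e, ⟨(Finset.univ.filter fun e' : Fin m × Fin 3 => vert₁ e' = vert₁ e ∧ idx e' < idx e).card / 2 ^ 60,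
      fiberRank_div_lt vert₁ idx hL e⟩⟩
  let dst : Fin m × Fin 3 → (Σ v : Option (Fin n), Fin (nb₂ v)) := fun e =>
    ⟨vert₂ e, ⟨(Finset.univ.filter fun e' : Fin m × Fin 3 => vert₂ e' = vert₂ e ∧ idx e' < idx e).card / 2 ^ 60,
      fiberRank_div_lt vert₂ idx hL e⟩⟩
  have hdeg₁ : ∀ x : (Σ v : Fin n, Fin (nb₁ v)),
      (Finset.univ.filter fun e => src e = x).card ≤ 2 ^ 60 := by
    intro x
    refine le_trans (Finset.card_le_card fun e he => ?_) (card_block_le vert₁ idx hidxinj hL x.1 x.2.val)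
    simp only [Finset.mem_filter, Finset.mem_univ, true_and] at he ⊢
    subst he
    exact ⟨rfl, rfl⟩
  have hdeg₂ : ∀ x : (Σ v : Option (Fin n), Fin (nb₂ v)),
      (Finset.univ.filter fun e => dst e = x).card ≤ 2 ^ 60 := by
    intro x
    refine le_trans (Finset.card_le_card fun e he => ?_) (card_block_le vert₂ idx hidxinj hL x.1 x.2.val)
    simp only [Finset.mem_filter, Finset.mem_univ, true_and] at he ⊢
    subst he
    exact ⟨rfl, rfl⟩
  have hdiv : (((m * 3) / 2 ^ 60 : ℕ) : ℝ) ≤ (m : ℝ) * 3 / 2 ^ 60 := by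
    calc (((m * 3) / 2 ^ 60 : ℕ) : ℝ) ≤ ((m * 3 : ℕ) : ℝ) / ((2 ^ 60 : ℕ) : ℝ) := Nat.cast_div_le
      _ = (m : ℝ) * 3 / 2 ^ 60 := by norm_num
  have hcardα : (Fintype.card (Σ v : Fin n, Fin (nb₁ v)) : ℝ) ≤ n + 3 * m / 2 ^ 60 := by
    have h0 := sum_blocks_le vert₁ hL
    rw [Fintype.card_fin, Fintype.card_prod, Fintype.card_fin, Fintype.card_fin] at h0
    have h1 : Fintype.card (Σ v : Fin n, Fin (nb₁ v)) ≤ n + (m * 3) / 2 ^ 60 := by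
      rw [Fintype.card_sigma]
      simp only [Fintype.card_fin]
      exact h0
    have h1' : (Fintype.card (Σ v : Fin n, Fin (nb₁ v)) : ℝ) ≤ ((n + (m * 3) / 2 ^ 60 : ℕ) : ℝ) := by
      exact_mod_cast h1
    rw [Nat.cast_add] at h1'
    linarith only [h1', hdiv]
  have hcardβ : (Fintype.card (Σ v : Option (Fin n), Fin (nb₂ v)) : ℝ) ≤ (n + 1) + 3 * m / 2 ^ 60 := by
    have h0 := sum_blocks_le vert₂ hL
    rw [Fintype.card_option, Fintype.card_fin, Fintype.card_prod, Fintype.card_fin, Fintype.card_fin] at h0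
    have h1 : Fintype.card (Σ v : Option (Fin n), Fin (nb₂ v)) ≤ (n + 1) + (m * 3) / 2 ^ 60 := by
      rw [Fintype.card_sigma]
      simp only [Fintype.card_fin]
      exact h0
    have h1' : (Fintype.card (Σ v : Option (Fin n), Fin (nb₂ v)) : ℝ)
        ≤ (((n + 1) + (m * 3) / 2 ^ 60 : ℕ) : ℝ) := by
      exact_mod_cast h1
    rw [Nat.cast_add, Nat.cast_add, Nat.cast_one] at h1'
    linarith only [h1', hdiv]
  have hN1 : 1 ≤ Fintype.card (Σ v : Fin n, Fin (nb₁ v)) + Fintype.card (Σ v : Option (Fin n), Fin (nb₂ v)) := by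
    have : 0 < Fintype.card (Σ v : Fin n, Fin (nb₁ v)) :=
      Fintype.card_pos_iff.2 ⟨⟨⟨0, hn⟩, ⟨0, lt_of_lt_of_le Nat.zero_lt_one (le_max_left 1 _)⟩⟩⟩
    omega
  refine ⟨nb₁, nb₂, src, dst, fun e => by simp only [src, hvert₁], fun e => by simp only [src, hvert₁, hidx],
    fun e => by simp only [dst, hvert₂], fun e => by simp only [dst, hvert₂, hidx],
    fun j ℓ => by simp only [src, hvert₁], fun j => by simp [dst, hvert₂],
    fun j => by simp [dst, hvert₂], fun j => by simp [dst, hvert₂],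
    hdeg₁, hdeg₂, hN1, by linarith only [hcardα, hcardβ]⟩

end Summit.PneNP.PneNP.Theorems.SfmBl
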